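/-
Copyright (c) 2026. All rights reserved.
Released under Apache 2.0 license as described in the file LICENSE.
Authors: HodgeCM publication cell (pub-hodgecm), GR lane, seat GR-2 (`pub-hodgecm-own-hyp34`).
-/
import Literature.NumberTheory.Weil1964.ArchFrameDictionaryGen
import Literature.NumberTheory.Weil1964.ArchActQuadraticRealSplitPlaces
import Literature.NumberTheory.Weil1964.ArchRealSplitFrameConj
import HarnessLib

/-!
# The frame dictionary at a real place of `F` SPLIT in `E` (place type (ii))

Sequel of `ArchFrameDictionaryGen` (type-(i) real places and complex places).  In the twisted general Folland frame
`scaledFrameGenT ψ (placeScale D) C` of `W_∞` (`ArchFollandFrameTwist`) with scaling `D_v = 1` at a real place `v`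
of `F` under a REAL place `w` of `E` (so `v` splits in `E`), and diagonal Gram matrix `T = diag t₀`:

* **`realSlice_archPhaseMap_archToAdelic_realSplit`** — the real `v`-slices of the archimedean phase map of
  `ι_𝔸 (g, 1)`, `g ∈ U(J)(E ⊗ ℝ)`, are `⇑(rsRealify (σ_v t₀) (toSymplectic (archAtRealSplit w g)))` applied to the
  `v`-slices — i.e. (by `ArchRealSplitFrameConj.rsRealify_toSymplectic`) the conjugate
  `κ_v⁻¹ · m(g_w) · κ_v` of Folland's Levi element of the `w`-component `g_w ∈ GL_N(ℝ)` by the framed split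
  Cayley element `κ_v = rsCayley`; the input of the CORE `ArchActQuadraticRealSplitPlaces.placeVec_archAct_archToAdelic_realSplit`
  and the slice formula `realSlice_archFolland_twist_diagonal`.

This is the type-(ii) part of the dictionary `archPhaseMap (ι(g,1)) = ⇑(proj (s_∞ g))` for the archimedean Weil
section over a general quadratic `E/F` (`E` with real places).  Topic `NumberTheory/Weil1964`; KERNEL only: theorems;
no `def … : Prop`, no named fact, no `sorry`.  Written for the stage-1 cell `pub-hodgecm` (GR lane); nothing here is a
claim of the manuscripts adjudicated by that cell.

## References
* S. Gelbart, J. Rogawski, Invent. Math. 105 (1991), §3.1 p. 454 [GelbartRogawski1991].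
* G. B. Folland, *Harmonic Analysis in Phase Space* (1989), Ch. 4 §1 Prop. (4.6), §4.2 (4.24) [Folland1989].
* C. Mœglin, M.-F. Vignéras, J.-L. Waldspurger, LNM 1291 (1987), Chap. 1 I.17, Chap. 2 III.1 [MoeglinVignerasWaldspurger1987].
-/

set_option autoImplicit false

noncomputable section

open scoped Matrix Classical
open Matrix NumberField NumberField.InfinitePlace NumberField.mixedEmbedding IsDedekindDomain
open Literature.RepresentationTheory.HeisenbergGroup
open Literature.RepresentationTheory.HeisenbergGroup.SymplecticMatrix
open Literature.Analysis.SegalBargmann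
open Literature.NumberTheory.Automorphic Literature.NumberTheory.Automorphic.UnitaryGroup

namespace Literature.NumberTheory.Weil1964

local notation "PV" σ => (σ → ℝ) × (σ → ℝ)
local notation "SpR" σ => symplecticGroup (polar (dotPairing σ))

variable (F : Type) [Field F] [NumberField F] (E : Type) [Field E] [NumberField E] [Algebra F E]
  [Algebra.IsQuadraticExtension F E] (c : E ≃ₐ[F] E) (hcc : c * c = 1) (N : ℕ)
  {δ : E} (hcδ : c δ = -δ) (hδ : δ ≠ 0) {d : F} (hd : δ * δ = algebraMap F E d)
  (t₀ : Fin N → F) (ht0 : ∀ j, t₀ j ≠ 0) {J : Matrix (Fin N) (Fin N) E} (hJ : J = (Matrix.diagonal t₀).map (algebraMap F E))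
  (D : {v : InfinitePlace F // v.IsReal} → Fin N → ℝ) (hD0 : ∀ v j, D v j ≠ 0)
  (ψ : {v : InfinitePlace F // v.IsComplex} → (ℂ →+* ℂ)) (hψ : ∀ v, Continuous (ψ v))
  (C : Fin N × {v : InfinitePlace F // v.IsComplex} → ℂ) (hC : ∀ k, C k ≠ 0)
  (v : {v : InfinitePlace F // v.IsReal}) (w : {w : InfinitePlace E // w.IsReal})
  (hover : w.1.comap (algebraMap F E) = v.1)

omit [NumberField F] in
include ht0 in
/-- the entries `σ_v(t₀ j)` of the local Gram matrix are non-zero. [cite: GelbartRogawski1991, §3.1 p. 454] -/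
theorem embedding_t₀_ne_zero (j : Fin N) : embedding_of_isReal v.2 (t₀ j) ≠ 0 :=
  (map_ne_zero _).2 (ht0 j)

omit [NumberField F] [NumberField E] [Algebra.IsQuadraticExtension F E] in
include hover in
/-- `σ_w(diag t₀) = diag (σ_v t₀)` for the real place `w` over `v` (`σ_w|_F = σ_v`). [cite: GelbartRogawski1991, §3.1 p. 454] -/
theorem map_realEmbOfPlace_diagonal :
    (Matrix.diagonal t₀).map (realEmbOfPlace F E w) = Matrix.diagonal fun j => embedding_of_isReal v.2 (t₀ j) := by
  rw [Matrix.diagonal_map (map_zero _)]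
  congr 1
  funext j
  apply Complex.ofReal_injective
  rw [realEmbOfPlace, RingHom.comp_apply, embedding_of_isReal_apply, embedding_of_isReal_apply, ← RingHom.comp_apply,
    embedding_comp_eq_of_isReal F E v.1 v.2 ⟨w.1, hover⟩]

include hcc hover in
/-- **the real slices at a SPLIT real place of the archimedean phase map of `ι_𝔸 (g, 1)`** in the twisted general frame
with scaling `1` at `v`: `⇑(rsRealify (σ_v t₀) (toSymplectic (archAtRealSplit w g)))` on the `v`-slices.
[cite: GelbartRogawski1991, §3.1 p. 454; MoeglinVignerasWaldspurger1987, Chap. 1 I.17] -/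
theorem realSlice_archPhaseMap_archToAdelic_realSplit (hT : (Matrix.diagonal t₀).IsSymm)
    (hTu : IsUnit (archMat F (Fin N) ((Matrix.diagonal t₀).map (algebraMap F (AdeleRing (𝓞 F) F)))))
    (hDv : ∀ j, D v j = 1) (g : UnitaryGroup.arch F E c N J) (pq : PV (FrameIdx F (Fin N))) :
    (realSlice (Fin N) v (archPhaseMap ((Matrix.diagonal t₀).map (algebraMap F (AdeleRing (𝓞 F) F)))
        (scaledFrameGenT F (Fin N) ψ hψ (placeScale N D) (placeScale_ne_zero N hD0) C hC) hTu
        (adelicToSymplectic F E c N hcδ hδ hd hT hJ (UnitaryGroup.archToAdelic F E c N J g)) pq).1,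
      realSlice (Fin N) v (archPhaseMap ((Matrix.diagonal t₀).map (algebraMap F (AdeleRing (𝓞 F) F)))
        (scaledFrameGenT F (Fin N) ψ hψ (placeScale N D) (placeScale_ne_zero N hD0) C hC) hTu
        (adelicToSymplectic F E c N hcδ hδ hd hT hJ (UnitaryGroup.archToAdelic F E c N J g)) pq).2) =
      ((rsRealify (fun j => embedding_of_isReal v.2 (t₀ j)) (embedding_t₀_ne_zero F N t₀ ht0 v)
          ((isQuadraticCoordinates_splitReal (embedding_of_isReal w.2 δ) (embedding_of_isReal_ne_zero E w hδ)).toSymplectic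
            (Fin N) (Matrix.isSymm_diagonal fun j => embedding_of_isReal v.2 (t₀ j)) swap_diag
            (swap_delta (embedding_of_isReal w.2 δ))
            (by rw [map_realEmbOfPlace_diagonal F E N t₀ v w hover])
            (archAtRealSplit F E c N hcc w (Matrix.diagonal t₀) hJ g)) : SpR (Fin N)).1 :
          (PV (Fin N)) ≃ₗ[ℝ] PV (Fin N))
        (realSlice (Fin N) v pq.1, realSlice (Fin N) v pq.2) := by
  set T𝔸 := (Matrix.diagonal t₀).map (algebraMap F (AdeleRing (𝓞 F) F)) with hT𝔸
  obtain ⟨⟨a, b⟩, rfl⟩ := (archFolland_bijective (T := T𝔸)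
    (scaledFrameGenT F (Fin N) ψ hψ (placeScale N D) (placeScale_ne_zero N hD0) C hC) hTu).2 pq
  rw [archPhaseMap_archFolland]
  set G := adelicToSymplectic F E c N hcδ hδ hd hT hJ (UnitaryGroup.archToAdelic F E c N J g) with hG
  have hD1 : (fun j => placeScale N D (j, v)) = fun _ => (1 : ℝ) := funext fun j => hDv j
  rw [show archAct T𝔸 G (a, b) = ((archAct T𝔸 G (a, b)).1, (archAct T𝔸 G (a, b)).2) from rfl,
    realSlice_archFolland_twist_diagonal, realSlice_archFolland_twist_diagonal, hD1]
  have hslice := placeVec_archAct_archToAdelic_realSplit F E c hcc N hcδ hδ hd hT hJ v w hover g a b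
  rw [show (placeVec F (Fin N) v (archAct T𝔸 G (a, b)).1, placeVec F (Fin N) v (archAct T𝔸 G (a, b)).2) = _ from hslice,
    IsQuadraticCoordinates.coe_toSymplectic, rsRealify_apply_follandScale, IsQuadraticCoordinates.coe_toSymplectic]

end Literature.NumberTheory.Weil1964

end
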